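import Literature.AlgebraicGeometry.HodgeTheory.LimitMixedHodgeStructureRelativeTateTwist
import Literature.AlgebraicGeometry.Motives.MixedHodgeStructureIndecomposableDual
import HarnessLib

/-!
# Socle, radical, Loewy length, simplicity and indecomposability are invariant under Tate twists

Cattani–El Zein–Griffiths–Lê, *Hodge Theory*, Ex. 3.2.23 (4) (p. 163): the Tate twist `H(j)` has the same
underlying space with shifted filtrations, and the sub-MHS of `H(j)` are exactly the twists `S(j)` of the sub-MHS of
`H` (the tree's `SubMixedHodgeStructure.tateTwist`, with `S(j).toMHS = S.toMHS(j)` and `H(j)/S(j) = (H/S)(j)`), while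
`H(j)` is semisimple iff `H` is (`isSemisimple_tateTwist_iff`). Hence every notion built from sub-MHS and
semisimplicity is twist-invariant. Namespace `MixedHodgeStructure`; everything proved, no named facts:

* §1 `SubMixedHodgeStructure.untwist` (a sub-MHS of `H(j)` seen in `H`), inverse to `tateTwist`;
* §2 **`socle_tateTwist`**, **`radical_tateTwist`**, **`socleSeries_tateTwist`**, `radicalSeries_tateTwist`,
  **`loewyLength_tateTwist`**;
* §3 **`isSimple_tateTwist_iff`**, **`isIndecomposable_tateTwist_iff`**.

## References

* [CattaniElZeinGriffithsLe2014] E. Cattani et al. (eds.), Hodge Theory (2014), Ex. 3.2.23 (4), Thm. 3.2.18, p. 270.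
-/

noncomputable section

namespace Literature.AlgebraicGeometry.Motives

namespace MixedHodgeStructure

universe u

variable {V : Type u} [AddCommGroup V] [Module ℚ V]
variable {H : MixedHodgeStructure V}

open Module

/-! ### §1 Untwisting sub-MHS -/

namespace SubMixedHodgeStructure

/-- **A sub-MHS of `H(j)` is a sub-MHS of `H`** (same subspace; compatibility with Deligne's splitting is
twist-invariant). [cite: CattaniElZeinGriffithsLe2014, Ex. 3.2.23 (4), p. 163] -/
def untwist {j : ℤ} (S' : SubMixedHodgeStructure (H.tateTwist j)) : SubMixedHodgeStructure H :=
  ofCompatible H S'.toSubmodule (by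
    rw [← iSup_inf_deligneFamily_tateTwist H j]
    exact S'.baseChange_le_iSup_inf)

/-- Same underlying subspace. [cite: CattaniElZeinGriffithsLe2014, Ex. 3.2.23 (4), p. 163] -/
@[simp]
theorem untwist_toSubmodule {j : ℤ} (S' : SubMixedHodgeStructure (H.tateTwist j)) :
    S'.untwist.toSubmodule = S'.toSubmodule := rfl

/-- `untwist (S(j)) = S`. [cite: CattaniElZeinGriffithsLe2014, Ex. 3.2.23 (4), p. 163] -/
theorem untwist_tateTwist (S : SubMixedHodgeStructure H) (j : ℤ) : (S.tateTwist j).untwist = S :=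
  ext rfl

/-- `(untwist S')(j) = S'`. [cite: CattaniElZeinGriffithsLe2014, Ex. 3.2.23 (4), p. 163] -/
theorem tateTwist_untwist {j : ℤ} (S' : SubMixedHodgeStructure (H.tateTwist j)) : S'.untwist.tateTwist j = S' :=
  ext rfl

/-- `S(j)` is semisimple iff `S` is. [cite: CattaniElZeinGriffithsLe2014, Ex. 3.2.23 (4) and p. 270] -/
theorem isSemisimple_tateTwist_toMixedHodgeStructure_iff (S : SubMixedHodgeStructure H) (j : ℤ) :
    (S.tateTwist j).toMixedHodgeStructure.IsSemisimple ↔ S.toMixedHodgeStructure.IsSemisimple := by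
  rw [toMixedHodgeStructure_tateTwist]
  exact isSemisimple_tateTwist_iff (H := S.toMixedHodgeStructure) j

/-- `untwist S'` is semisimple iff `S'` is. [cite: CattaniElZeinGriffithsLe2014, Ex. 3.2.23 (4) and p. 270] -/
theorem isSemisimple_untwist_iff {j : ℤ} (S' : SubMixedHodgeStructure (H.tateTwist j)) :
    S'.untwist.toMixedHodgeStructure.IsSemisimple ↔ S'.toMixedHodgeStructure.IsSemisimple := by
  rw [← isSemisimple_tateTwist_toMixedHodgeStructure_iff S'.untwist j, tateTwist_untwist]

/-- `H(j)/S(j)` is semisimple iff `H/S` is. [cite: CattaniElZeinGriffithsLe2014, Ex. 3.2.23 (4) and p. 270] -/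
theorem isSemisimple_tateTwist_quotient_iff (S : SubMixedHodgeStructure H) (j : ℤ) :
    (S.tateTwist j).quotient.IsSemisimple ↔ S.quotient.IsSemisimple := by
  rw [quotient_tateTwist]
  exact isSemisimple_tateTwist_iff (H := S.quotient) j

/-- `H/untwist S'` is semisimple iff `H(j)/S'` is. [cite: CattaniElZeinGriffithsLe2014, Ex. 3.2.23 (4) and p. 270] -/
theorem isSemisimple_untwist_quotient_iff {j : ℤ} (S' : SubMixedHodgeStructure (H.tateTwist j)) :
    S'.untwist.quotient.IsSemisimple ↔ S'.quotient.IsSemisimple := by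
  rw [← isSemisimple_tateTwist_quotient_iff S'.untwist j, tateTwist_untwist]

end SubMixedHodgeStructure

open SubMixedHodgeStructure

/-! ### §2 Socle, radical, both series and the Loewy length -/

section Invariants

variable [FiniteDimensional ℚ V]

/-- **`soc(H(j)) = (soc H)(j)`** (as subspaces of `V`: equal). [cite: CattaniElZeinGriffithsLe2014, Ex. 3.2.23 (4) and p. 270] -/
theorem socle_tateTwist (H : MixedHodgeStructure V) (j : ℤ) :
    (socle (H.tateTwist j)).toSubmodule = (socle H).toSubmodule := by
  refine le_antisymm ?_ ?_
  · have h := le_socle (socle (H.tateTwist j)).untwist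
      ((isSemisimple_untwist_iff _).2 (isSemisimple_socle (H.tateTwist j)))
    rwa [untwist_toSubmodule] at h
  · have h := le_socle ((socle H).tateTwist j)
      ((isSemisimple_tateTwist_toMixedHodgeStructure_iff _ j).2 (isSemisimple_socle H))
    rwa [tateTwist_toSubmodule] at h

/-- As sub-MHS: `soc(H(j)) = (soc H)(j)`. [cite: CattaniElZeinGriffithsLe2014, Ex. 3.2.23 (4) and p. 270] -/
theorem socle_tateTwist_eq (H : MixedHodgeStructure V) (j : ℤ) : socle (H.tateTwist j) = (socle H).tateTwist j :=
  SubMixedHodgeStructure.ext (socle_tateTwist H j)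

/-- **`rad(H(j)) = (rad H)(j)`.** [cite: CattaniElZeinGriffithsLe2014, Ex. 3.2.23 (4) and p. 270] -/
theorem radical_tateTwist (H : MixedHodgeStructure V) (j : ℤ) :
    (radical (H.tateTwist j)).toSubmodule = (radical H).toSubmodule := by
  refine le_antisymm ?_ ?_
  · have h := radical_le ((radical H).tateTwist j)
      ((isSemisimple_tateTwist_quotient_iff _ j).2 (isSemisimple_quotient_radical H))
    rwa [tateTwist_toSubmodule] at h
  · have h := radical_le (radical (H.tateTwist j)).untwist
      ((isSemisimple_untwist_quotient_iff _).2 (isSemisimple_quotient_radical (H.tateTwist j)))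
    rwa [untwist_toSubmodule] at h

/-- As sub-MHS: `rad(H(j)) = (rad H)(j)`. [cite: CattaniElZeinGriffithsLe2014, Ex. 3.2.23 (4) and p. 270] -/
theorem radical_tateTwist_eq (H : MixedHodgeStructure V) (j : ℤ) :
    radical (H.tateTwist j) = (radical H).tateTwist j :=
  SubMixedHodgeStructure.ext (radical_tateTwist H j)

/-- **`soc^k(H(j)) = (soc^k H)(j)`** as sub-MHS. [cite: CattaniElZeinGriffithsLe2014, Ex. 3.2.23 (4) and p. 270] -/
theorem socleSeries_tateTwist_eq (H : MixedHodgeStructure V) (j : ℤ) (k : ℕ) :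
    socleSeries (H.tateTwist j) k = (socleSeries H k).tateTwist j := by
  induction k with
  | zero => exact SubMixedHodgeStructure.ext rfl
  | succ k ih =>
    refine SubMixedHodgeStructure.ext ?_
    have e1 : (socle (socleSeries (H.tateTwist j) k).quotient).toSubmodule.comap
        (socleSeries (H.tateTwist j) k).mkQ.toLinearMap =
        (socle ((socleSeries H k).tateTwist j).quotient).toSubmodule.comap ((socleSeries H k).tateTwist j).mkQ.toLinearMap :=
      congrArg (fun Z : SubMixedHodgeStructure (H.tateTwist j) => (socle Z.quotient).toSubmodule.comap Z.mkQ.toLinearMap) ih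
    have e2 : (socle ((socleSeries H k).tateTwist j).quotient).toSubmodule =
        (socle ((socleSeries H k).quotient.tateTwist j)).toSubmodule :=
      congrArg (fun M => (socle M).toSubmodule) (quotient_tateTwist (socleSeries H k) j)
    rw [socleSeries_succ_toSubmodule, e1, e2, socle_tateTwist]
    rfl

/-- `soc^k(H(j))` and `soc^k H` have the same underlying subspace. [cite: CattaniElZeinGriffithsLe2014, Ex. 3.2.23 (4)] -/
theorem socleSeries_tateTwist (H : MixedHodgeStructure V) (j : ℤ) (k : ℕ) :
    (socleSeries (H.tateTwist j) k).toSubmodule = (socleSeries H k).toSubmodule := by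
  rw [socleSeries_tateTwist_eq]; rfl

/-- **`rad^k(H(j)) = (rad^k H)(j)`** as sub-MHS. [cite: CattaniElZeinGriffithsLe2014, Ex. 3.2.23 (4) and p. 270] -/
theorem radicalSeries_tateTwist_eq (H : MixedHodgeStructure V) (j : ℤ) (k : ℕ) :
    radicalSeries (H.tateTwist j) k = (radicalSeries H k).tateTwist j := by
  induction k with
  | zero => exact SubMixedHodgeStructure.ext rfl
  | succ k ih =>
    refine SubMixedHodgeStructure.ext ?_
    have e1 : (radical (radicalSeries (H.tateTwist j) k).toMixedHodgeStructure).toSubmodule.map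
        (radicalSeries (H.tateTwist j) k).subtype.toLinearMap =
        (radical ((radicalSeries H k).tateTwist j).toMixedHodgeStructure).toSubmodule.map
          ((radicalSeries H k).tateTwist j).subtype.toLinearMap :=
      congrArg (fun Z : SubMixedHodgeStructure (H.tateTwist j) =>
        (radical Z.toMixedHodgeStructure).toSubmodule.map Z.subtype.toLinearMap) ih
    have e2 : (radical ((radicalSeries H k).tateTwist j).toMixedHodgeStructure).toSubmodule =
        (radical ((radicalSeries H k).toMixedHodgeStructure.tateTwist j)).toSubmodule :=
      congrArg (fun M => (radical M).toSubmodule) (toMixedHodgeStructure_tateTwist (radicalSeries H k) j)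
    rw [radicalSeries_succ_toSubmodule, e1, e2, radical_tateTwist]
    rfl

/-- `rad^k(H(j))` and `rad^k H` have the same underlying subspace. [cite: CattaniElZeinGriffithsLe2014, Ex. 3.2.23 (4)] -/
theorem radicalSeries_tateTwist (H : MixedHodgeStructure V) (j : ℤ) (k : ℕ) :
    (radicalSeries (H.tateTwist j) k).toSubmodule = (radicalSeries H k).toSubmodule := by
  rw [radicalSeries_tateTwist_eq]; rfl

/-- **`ℓ(H(j)) = ℓ(H)`.** [cite: CattaniElZeinGriffithsLe2014, Ex. 3.2.23 (4) and p. 270] -/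
theorem loewyLength_tateTwist (H : MixedHodgeStructure V) (j : ℤ) : loewyLength (H.tateTwist j) = loewyLength H := by
  apply le_antisymm
  · rw [loewyLength_le_iff, socleSeries_tateTwist]; exact socleSeries_loewyLength_eq_top H
  · rw [loewyLength_le_iff, ← socleSeries_tateTwist H j]; exact socleSeries_loewyLength_eq_top (H.tateTwist j)

end Invariants

/-! ### §3 Simple and indecomposable -/

/-- **`H(j)` is simple iff `H` is.** [cite: CattaniElZeinGriffithsLe2014, Ex. 3.2.23 (4) and p. 270] -/
theorem isSimple_tateTwist_iff (H : MixedHodgeStructure V) (j : ℤ) : (H.tateTwist j).IsSimple ↔ H.IsSimple := by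
  constructor
  · rintro ⟨hV, h⟩
    exact ⟨hV, fun S => h (S.tateTwist j)⟩
  · rintro ⟨hV, h⟩
    exact ⟨hV, fun S' => h S'.untwist⟩

/-- Tate twists of simple MHS are simple. [cite: CattaniElZeinGriffithsLe2014, Ex. 3.2.23 (4)] -/
theorem IsSimple.tateTwist (h : H.IsSimple) (j : ℤ) : (H.tateTwist j).IsSimple :=
  (isSimple_tateTwist_iff H j).2 h

/-- **`H(j)` is indecomposable iff `H` is.** [cite: CattaniElZeinGriffithsLe2014, Ex. 3.2.23 (4) and p. 270] -/
theorem isIndecomposable_tateTwist_iff (H : MixedHodgeStructure V) (j : ℤ) :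
    (H.tateTwist j).IsIndecomposable ↔ H.IsIndecomposable := by
  constructor
  · rintro ⟨hV, h⟩
    exact ⟨hV, fun S T hST => h (S.tateTwist j) (T.tateTwist j) hST⟩
  · rintro ⟨hV, h⟩
    exact ⟨hV, fun S' T' hST => h S'.untwist T'.untwist hST⟩

/-- Tate twists of indecomposable MHS are indecomposable. [cite: CattaniElZeinGriffithsLe2014, Ex. 3.2.23 (4)] -/
theorem IsIndecomposable.tateTwist (h : H.IsIndecomposable) (j : ℤ) : (H.tateTwist j).IsIndecomposable :=
  (isIndecomposable_tateTwist_iff H j).2 h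

/-- The Tate structures `ℚ(j)` have Loewy length `1`. [cite: CattaniElZeinGriffithsLe2014, p. 270] -/
theorem loewyLength_tate (j : ℤ) : loewyLength (HodgeStructure.tate j).toMixedHodgeStructure = 1 :=
  (HodgeStructure.isSemisimple_tate j).loewyLength_eq_one

end MixedHodgeStructure

end Literature.AlgebraicGeometry.Motives
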